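import Summits.NavierStokesRegularity.NavierStokesRegularity.Theorems.TypeILiouvilleTypeIliouvilleLPersistentLpRecurrence
import HarnessLib

/-!
# Finite space–time `Lᵖ` budget against a uniform stream kills a mild bounded ancient solution
# (crux `TypeIliouvilleL`, stmt-NavierStokesRegularity-10661, persistent stub S3ᵐ)

Helper file (theorems only, no definition, no named fact, no `sorry`; lands
`--supports stmt-NavierStokesRegularity-10661`), continuing
`TypeILiouvilleTypeIliouvilleLPersistentLpRecurrence`: there, a mild bounded ancient solution of
Navier–Stokes in print's class (KNSS 2009 §4 (i)) which is `Lᵖ`-close (`0 < p ≤ 3`, norms `≤ M`) to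
ONE constant drift `b` along SOME sequence of times `τ_k → −∞` is the drift
(`oseenMild_const_of_backward_Lp_const`, via Albritton–Barker 2019 Thm 1.2). Here the sequence is
produced from a space–time budget:

* `oseenMild_const_of_spaceTime_Lp_const` — if `∫_{t<T} ∫_{ℝ³} |v − b|ᵖ dx dt < ∞` for some
  `T ≤ 0`, one constant `b` and one real `0 < p ≤ 3`, then `v ≡ b` (Tonelli; every half-line
  `(−∞,S)` has infinite length, so it contains a slice of budget `≤ 1`);
* `oseenMild_const_of_spaceTime_finiteEnergy_const` — the case `p = 2`: (L) holds in the class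
  "uniform stream + finite space–time energy on a past slab".

So a counterexample to the persistent stub S3ᵐ (equivalently to (L) on the persistent class) has
INFINITE space–time `Lᵖ` budget against every constant on every past slab, for every `p ≤ 3`.
Nothing here proves S3ᵐ, (L), or anything about Navier–Stokes regularity.
-/

set_option linter.dupNamespace false

namespace Summit.NavierStokesRegularity.NavierStokesRegularity.Theorems

open MeasureTheory Filter Set Function
open scoped ENNReal NNReal Topology
open Literature.Analysis Literature.Analysis.FluidPDE

/-- **Finite space–time `Lᵖ` budget against a uniform stream on a past slab kills a mild bounded
ancient solution (`0 < p ≤ 3`).** Let `v` be continuous and uniformly bounded on `(−∞,0) × ℝ³`,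
weakly divergence free on every slice and Oseen-mild. If for one constant vector `b`, one real
exponent `0 < p ≤ 3` and one `T ≤ 0` the space–time integral `∫_{t<T} ∫_{ℝ³} |v(t,x) − b|ᵖ dx dt`
is finite, then `v ≡ b` on the whole slab. Proof: by Tonelli the slice integrals
`G(t) = ∫ |v(t) − b|ᵖ` have `∫_{t<S} G < ∞` for every `S ≤ T`, so (Lebesgue measure of `(−∞,S)`
being infinite) each such half-line contains a time with `G ≤ 1`; this gives times `τ_k < −k`
with `‖v(τ_k) − b‖_{Lᵖ} ≤ 1`, and `oseenMild_const_of_backward_Lp_const` applies. (So (L) holds in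
the class "constant + `Lᵖ((−∞,T) × ℝ³)`", `p ≤ 3`; the persistent stub S3ᵐ is about flows with
infinite space–time budget against every constant.) [cite: AlbrittonBarker2019, Thm 1.2 (arXiv:1811.00502 p. 4)] -/
theorem oseenMild_const_of_spaceTime_Lp_const
    (v : ℝ → EuclideanSpace ℝ (Fin 3) → EuclideanSpace ℝ (Fin 3)) (b : EuclideanSpace ℝ (Fin 3))
    {p : ℝ} (hp0 : 0 < p) (hp3 : p ≤ 3) {T : ℝ} (hT : T ≤ 0)
    (hvc : ContinuousOn (uncurry v) (Iio 0 ×ˢ univ))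
    (hvK : ∃ K : ℝ, ∀ t < 0, ∀ x, ‖v t x‖ ≤ K)
    (hvd : ∀ t < 0, IsWeaklyDivFree (v t))
    (hvm : ∀ s t : ℝ, s < t → t < 0 → ∀ x,
      v t x = UnboundedOperators.heatExtension (v s) (t - s) x - oseenDuhamel 1 s v v t x)
    (hfin : (∫⁻ z in Iio T ×ˢ (univ : Set (EuclideanSpace ℝ (Fin 3))), ‖v z.1 z.2 - b‖ₑ ^ p) < ∞) :
    ∀ t < 0, ∀ x, v t x = b := by
  -- the integrand is continuous on the open past slab, hence a.e.-measurable there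
  set g : ℝ × EuclideanSpace ℝ (Fin 3) → ℝ≥0∞ := fun z => ‖v z.1 z.2 - b‖ₑ ^ p with hg
  have hslab : Iio T ×ˢ (univ : Set (EuclideanSpace ℝ (Fin 3))) ⊆ Iio 0 ×ˢ univ :=
    prod_mono (Iio_subset_Iio hT) le_rfl
  have hgc : ContinuousOn g (Iio T ×ˢ (univ : Set (EuclideanSpace ℝ (Fin 3)))) := by
    have h1 : ContinuousOn (fun z : ℝ × EuclideanSpace ℝ (Fin 3) => uncurry v z - b)
        (Iio T ×ˢ (univ : Set (EuclideanSpace ℝ (Fin 3)))) := (hvc.mono hslab).sub continuousOn_const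
    exact (ENNReal.continuous_rpow_const.comp_continuousOn (continuous_enorm.comp_continuousOn h1))
  have hmeasT : MeasurableSet (Iio T ×ˢ (univ : Set (EuclideanSpace ℝ (Fin 3)))) :=
    measurableSet_Iio.prod MeasurableSet.univ
  have hgm : AEMeasurable g ((volume : Measure (ℝ × EuclideanSpace ℝ (Fin 3))).restrict
      (Iio T ×ˢ (univ : Set (EuclideanSpace ℝ (Fin 3))))) := hgc.aemeasurable hmeasT
  -- Tonelli on the restricted product measure
  have hprod : ((volume : Measure ℝ).restrict (Iio T)).prod
      ((volume : Measure (EuclideanSpace ℝ (Fin 3))).restrict univ) =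
      (volume : Measure (ℝ × EuclideanSpace ℝ (Fin 3))).restrict
        (Iio T ×ˢ (univ : Set (EuclideanSpace ℝ (Fin 3)))) := by
    rw [Measure.prod_restrict, ← Measure.volume_eq_prod]
  have hgm' : AEMeasurable g (((volume : Measure ℝ).restrict (Iio T)).prod
      ((volume : Measure (EuclideanSpace ℝ (Fin 3))).restrict univ)) := by
    rw [hprod]; exact hgm
  set G : ℝ → ℝ≥0∞ := fun t => ∫⁻ x, ‖v t x - b‖ₑ ^ p with hG
  have hTon : ∫⁻ t in Iio T, G t = ∫⁻ z in Iio T ×ˢ (univ : Set (EuclideanSpace ℝ (Fin 3))), g z := by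
    rw [← hprod, lintegral_prod g hgm']
    simp only [hG, hg, Measure.restrict_univ]
  have hGfin : ∫⁻ t in Iio T, G t < ∞ := by rw [hTon]; exact hfin
  -- every half-line `(−∞, S)`, `S ≤ T`, contains a time with slice budget at most one
  have hclaim : ∀ S : ℝ, S ≤ T → ∃ t, t < S ∧ G t ≤ 1 := by
    intro S hS
    by_contra h
    push Not at h
    have h1 : ∫⁻ t in Iio S, (1 : ℝ≥0∞) ≤ ∫⁻ t in Iio S, G t :=
      setLIntegral_mono' measurableSet_Iio fun t ht => (h t ht).le
    rw [setLIntegral_one, Real.volume_Iio, top_le_iff] at h1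
    have h2 : ∫⁻ t in Iio S, G t ≤ ∫⁻ t in Iio T, G t := lintegral_mono_set (Iio_subset_Iio hS)
    rw [h1, top_le_iff] at h2
    exact (lt_irrefl _) (h2 ▸ hGfin)
  choose τ hτ using fun n : ℕ => hclaim (min T (-(n : ℝ))) (min_le_left _ _)
  have hτ0 : ∀ k, τ k < 0 := fun k => ((hτ k).1.trans_le (min_le_left _ _)).trans_le hT
  have hτlim : Tendsto τ atTop atBot := by
    refine tendsto_atBot_mono (fun n => ((hτ n).1.le.trans (min_le_right _ _))) ?_
    exact tendsto_neg_atTop_atBot.comp tendsto_natCast_atTop_atTop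
  -- `Lᵖ` norms `≤ 1` along `τ k`
  set q : ℝ≥0∞ := ENNReal.ofReal p with hq
  have hq0 : q ≠ 0 := (ENNReal.ofReal_pos.2 hp0).ne'
  have hqt : q ≠ ∞ := ENNReal.ofReal_ne_top
  have hq3 : q ≤ 3 := (ENNReal.ofReal_le_ofReal hp3).trans_eq (by norm_num)
  have hqr : q.toReal = p := ENNReal.toReal_ofReal hp0.le
  have hnorm : ∀ k, eLpNorm (fun x => v (τ k) x - b) q
      (volume : Measure (EuclideanSpace ℝ (Fin 3))) ≤ 1 := by
    intro k
    rw [eLpNorm_eq_lintegral_rpow_enorm_toReal hq0 hqt, hqr]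
    exact ENNReal.rpow_le_one (hτ k).2 (by positivity)
  exact oseenMild_const_of_backward_Lp_const v b hq0 hq3 hvc hvK hvd hvm
    ⟨τ, 1, ENNReal.one_lt_top, hτlim, hτ0, hnorm⟩

/-- **Finite space–time energy against a uniform stream (`p = 2`).** A mild bounded ancient
solution with `∫_{t<T} ∫_{ℝ³} |v(t,x) − b|² dx dt < ∞` for some `T ≤ 0` and some constant `b` is the
uniform stream `b`. [cite: AlbrittonBarker2019, Thm 1.2 (arXiv:1811.00502 p. 4)] -/
theorem oseenMild_const_of_spaceTime_finiteEnergy_const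
    (v : ℝ → EuclideanSpace ℝ (Fin 3) → EuclideanSpace ℝ (Fin 3)) (b : EuclideanSpace ℝ (Fin 3))
    {T : ℝ} (hT : T ≤ 0)
    (hvc : ContinuousOn (uncurry v) (Iio 0 ×ˢ univ))
    (hvK : ∃ K : ℝ, ∀ t < 0, ∀ x, ‖v t x‖ ≤ K)
    (hvd : ∀ t < 0, IsWeaklyDivFree (v t))
    (hvm : ∀ s t : ℝ, s < t → t < 0 → ∀ x,
      v t x = UnboundedOperators.heatExtension (v s) (t - s) x - oseenDuhamel 1 s v v t x)
    (hfin : (∫⁻ z in Iio T ×ˢ (univ : Set (EuclideanSpace ℝ (Fin 3))),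
      ‖v z.1 z.2 - b‖ₑ ^ (2 : ℝ)) < ∞) :
    ∀ t < 0, ∀ x, v t x = b :=
  oseenMild_const_of_spaceTime_Lp_const v b (p := 2) two_pos (by norm_num) hT hvc hvK hvd hvm hfin


/-- **Infinite space–time budget of non-constant flows.** If a mild bounded ancient solution is not
identically the constant `b` on the slab, then `∫_{t<T} ∫_{ℝ³} |v − b|ᵖ dx dt = ∞` for every
`T ≤ 0` and every real `0 < p ≤ 3` (contrapositive of `oseenMild_const_of_spaceTime_Lp_const`).
[cite: AlbrittonBarker2019, Thm 1.2 (arXiv:1811.00502 p. 4)] -/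
theorem spaceTime_lintegral_eq_top_of_ne_const
    (v : ℝ → EuclideanSpace ℝ (Fin 3) → EuclideanSpace ℝ (Fin 3)) (b : EuclideanSpace ℝ (Fin 3))
    {p : ℝ} (hp0 : 0 < p) (hp3 : p ≤ 3) {T : ℝ} (hT : T ≤ 0)
    (hvc : ContinuousOn (uncurry v) (Iio 0 ×ˢ univ))
    (hvK : ∃ K : ℝ, ∀ t < 0, ∀ x, ‖v t x‖ ≤ K)
    (hvd : ∀ t < 0, IsWeaklyDivFree (v t))
    (hvm : ∀ s t : ℝ, s < t → t < 0 → ∀ x,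
      v t x = UnboundedOperators.heatExtension (v s) (t - s) x - oseenDuhamel 1 s v v t x)
    (hne : ∃ t < 0, ∃ x, v t x ≠ b) :
    (∫⁻ z in Iio T ×ˢ (univ : Set (EuclideanSpace ℝ (Fin 3))), ‖v z.1 z.2 - b‖ₑ ^ p) = ∞ := by
  by_contra hfin
  obtain ⟨t, ht, x, hx⟩ := hne
  exact hx (oseenMild_const_of_spaceTime_Lp_const v b hp0 hp3 hT hvc hvK hvd hvm
    (lt_top_iff_ne_top.2 hfin) t ht x)

/-- **The `Lᵖ` distance to every constant diverges in the far past (`0 < p ≤ 3`).** If a mild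
bounded ancient solution is not identically the constant `b` on the slab, then
`‖v(t) − b‖_{Lᵖ(ℝ³)} → ∞` as `t → −∞` (in `ℝ≥0∞`, i.e. `Tendsto … atBot (𝓝 ∞)`): otherwise some
level `M < ∞` is undershot at times `τ_k ≤ −(k+1)`, and `oseenMild_const_of_backward_Lp_const`
forces `v ≡ b`. For S3ᵐ: a persistent would-be counterexample is, for every constant `b` and every
`p ≤ 3` (in particular in energy, `p = 2`), infinitely far from `b` in the far past — no bounded
subsequence of `‖v(τ) − b‖_{Lᵖ}` exists along any `τ → −∞`.
[cite: AlbrittonBarker2019, Thm 1.2 (arXiv:1811.00502 p. 4)] -/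
theorem tendsto_eLpNorm_sub_const_atBot_nhds_top_of_ne_const
    (v : ℝ → EuclideanSpace ℝ (Fin 3) → EuclideanSpace ℝ (Fin 3)) (b : EuclideanSpace ℝ (Fin 3))
    {p : ℝ≥0∞} (hp0 : p ≠ 0) (hp3 : p ≤ 3)
    (hvc : ContinuousOn (uncurry v) (Iio 0 ×ˢ univ))
    (hvK : ∃ K : ℝ, ∀ t < 0, ∀ x, ‖v t x‖ ≤ K)
    (hvd : ∀ t < 0, IsWeaklyDivFree (v t))
    (hvm : ∀ s t : ℝ, s < t → t < 0 → ∀ x,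
      v t x = UnboundedOperators.heatExtension (v s) (t - s) x - oseenDuhamel 1 s v v t x)
    (hne : ∃ t < 0, ∃ x, v t x ≠ b) :
    Tendsto (fun t => eLpNorm (fun x => v t x - b) p (volume : Measure (EuclideanSpace ℝ (Fin 3))))
      atBot (𝓝 ∞) := by
  rw [ENNReal.tendsto_nhds_top_iff_nnreal]
  intro M
  by_contra hM
  rw [eventually_atBot] at hM
  push Not at hM
  -- times `τ k ≤ -(k+1)` at which the `Lᵖ` distance to `b` is at most `M`
  choose τ hτ using fun k : ℕ => hM (-((k : ℝ) + 1))
  have hτ0 : ∀ k, τ k < 0 := fun k => (hτ k).1.trans_lt (by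
    have : (0 : ℝ) ≤ k := Nat.cast_nonneg k
    linarith)
  have hτlim : Tendsto τ atTop atBot := by
    refine tendsto_atBot_mono (fun k => (hτ k).1) ?_
    have h1 : Tendsto (fun k : ℕ => (k : ℝ) + 1) atTop atTop :=
      tendsto_natCast_atTop_atTop.atTop_add tendsto_const_nhds
    exact tendsto_neg_atTop_atBot.comp h1
  have hle : ∀ k, eLpNorm (fun x => v (τ k) x - b) p
      (volume : Measure (EuclideanSpace ℝ (Fin 3))) ≤ (M : ℝ≥0∞) := fun k => (hτ k).2
  obtain ⟨t, ht, x, hx⟩ := hne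
  exact hx (oseenMild_const_of_backward_Lp_const v b hp0 hp3 hvc hvK hvd hvm
    ⟨τ, M, ENNReal.coe_lt_top, hτlim, hτ0, hle⟩ t ht x)

end Summit.NavierStokesRegularity.NavierStokesRegularity.Theorems
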